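import Literature.NumberTheory.LFunctions.WeilFinitePrimeQuadraticChar
import Literature.NumberTheory.LFunctions.WeilLogLatticeComb
import Mathlib.Analysis.SpecialFunctions.Trigonometric.Sinc
import Mathlib.Analysis.SpecialFunctions.Integrals.Basic
import Mathlib.MeasureTheory.Integral.Prod
import HarnessLib

/-!
# Atom annihilation for dual (format-D) certificates of the twisted Weil form

Cell `rh-explicit`, WEIL TRACK — GRH ARM (Lean root `Summits/Ventures/WeilGRH/`, namespace
`Summit.Ventures.WeilGRH`).  Vocabulary: `Literature/NumberTheory/LFunctions/WeilExplicit.lean`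
(`IsWeilTest`, `weilMellin`, `k = g ⋆ g̃ = weilConv g (weilReflect g)`) and
`WeilFinitePrimeQuadraticChar.lean` (the analytic form `Re Q_χ(g) = (1/2π)∫|ĝ(1/2+iτ)|² M_{χ,N}(τ)dτ`).
First of two files formalising LEMMA D of the arm's FORMAT D (weil-grh-3,
`run/shared/lean/pub/rh-explicit/weil-grh-3/GRH3-ROUTE.md` §1, §1b, §4b); the soundness statement itself is
`DualCertificateSoundness.lean`.  Everything here is PROVED (no named facts, no `sorry`).

An ATOM of a format-D certificate is `c · τ^j · sinc(wτ/2)^m · cos(xτ)` or `… · sin(xτ)` (envelopes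
`pt, tri, sp4, sp6` = `m = 0, 2, 4, 6`, `w ≥ 0`), admissible for the window `[-t, t]` when
`x − m·w/2 ≥ 2t`: it is the transform of (a `j`-th derivative of) the `m`-fold box spline of step `w`
centred at `x`, supported in `[x − m·w/2, x + m·w/2] ⊆ [2t, ∞)`, where `k = g ⋆ g̃` and all its
derivatives vanish when `tsupport g ⊆ [-t, t]`.

## Results

* `integral_window_cexp` — `∫_{y−w/2}^{y+w/2} e^{−iτu} du = w · sinc(wτ/2) · e^{−iτy}` (all real `w, y, τ`).
* `integral_weilMellin_mul_sinc_pow_mul_cexp_eq_zero` — ANNIHILATION: for a test function `H` vanishing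
  on `[b, ∞)`, `w ≥ 0`, every `m` and every `y ≥ b + m·w/2`: `∫ Ĥ(1/2+iτ) sinc(wτ/2)^m e^{−iτy} dτ = 0`
  — induction on `m`: the base case is Mellin inversion on the critical line (`weilMellin_inversion`),
  the step writes the last `sinc` factor as a window integral and swaps (Fubini), the inner points
  `u ≥ y − w/2 ≥ b + (m−1)·w/2`.  No spline transform is ever computed.
* `weilMellin_iterate_deriv_weilConv_weilReflect_half` — with the tree's `weilMellin_iterate_deriv`
  (`(H^{(j)})^(s) = (−(s − 1/2))^j Ĥ(s)`, `WeilLogLatticeComb.lean`):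
  `((g ⋆ g̃)^{(j)})^(1/2+iτ) = (−iτ)^j |ĝ(1/2+iτ)|²`;
  `integrable_norm_sq_weilMellin_mul_pow` — `|ĝ(1/2+iτ)|² τ^j` is integrable for every `j`.
* `integral_norm_sq_weilMellin_mul_atom_eq_zero` — for `tsupport g ⊆ [-t, t]`, all `j, m : ℕ`, `w ≥ 0`
  and `x ≥ 2t + m·w/2`:
  `∫ |ĝ(1/2+iτ)|² τ^j sinc(wτ/2)^m cos(xτ) dτ = 0 = ∫ |ĝ(1/2+iτ)|² τ^j sinc(wτ/2)^m sin(xτ) dτ`.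

## References

* E. Bombieri, *Remarks on Weil's quadratic functional in the theory of prime numbers I*, Rend. Mat.
  Acc. Lincei (9) 11 (2000) — §2 (Mellin inversion on `Re s = 1/2`).
-/

noncomputable section

open Complex Filter Set MeasureTheory
open scoped Real Topology ComplexConjugate

namespace Summit.Ventures.WeilGRH

open Literature.NumberTheory.LFunctions

variable {g : ℝ → ℂ}

/-! ## The window integral `∫_{y-w/2}^{y+w/2} e^{-iτu} du = w · sinc(wτ/2) · e^{-iτy}` -/

/-- `e^{-iθ} − e^{iθ} = −2i sin θ`. [folklore] -/
private theorem cexp_neg_mul_I_sub_cexp_mul_I (θ : ℝ) :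
    cexp (-(θ : ℂ) * I) - cexp ((θ : ℂ) * I) = -(2 * I * Real.sin θ) := by
  rw [Complex.ofReal_sin, Complex.sin]
  have hI : I * I = -1 := Complex.I_mul_I
  linear_combination (cexp (-(θ : ℂ) * I) - cexp ((θ : ℂ) * I)) * hI

/-- **The window integral**: `∫_{y-w/2}^{y+w/2} e^{-iτu} du = w · sinc(wτ/2) · e^{-iτy}` for all real
`w, y, τ` (the transform of the indicator of an interval of length `w` centred at `y`; at `τ = 0` both
sides are `w`). [folklore] -/
theorem integral_window_cexp (w y τ : ℝ) :
    ∫ u in (y - w / 2)..(y + w / 2), cexp (-(τ * I) * u) =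
      ((w * Real.sinc (w * τ / 2) : ℝ) : ℂ) * cexp (-(τ * I) * y) := by
  rcases eq_or_ne τ 0 with rfl | hτ
  · simp
  rcases eq_or_ne w 0 with rfl | hw
  · simp
  have hc : (-(τ * I) : ℂ) ≠ 0 := by
    simp [hτ, Complex.I_ne_zero]
  rw [integral_exp_mul_complex hc, Real.sinc_of_ne_zero (by positivity)]
  have e1 : -(τ * I) * ((y + w / 2 : ℝ) : ℂ) = -(τ * I) * y + -((w * τ / 2 : ℝ) : ℂ) * I := by
    push_cast; ring
  have e2 : -(τ * I) * ((y - w / 2 : ℝ) : ℂ) = -(τ * I) * y + ((w * τ / 2 : ℝ) : ℂ) * I := by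
    push_cast; ring
  rw [e1, e2, Complex.exp_add, Complex.exp_add, ← mul_sub, cexp_neg_mul_I_sub_cexp_mul_I]
  have hτ' : (τ : ℂ) ≠ 0 := Complex.ofReal_ne_zero.2 hτ
  have hw' : (w : ℂ) ≠ 0 := Complex.ofReal_ne_zero.2 hw
  push_cast
  field_simp

/-! ## Annihilation: kernels vanishing beyond the window kill the atoms -/

/-- If a test function `H` vanishes at `y` then `∫ Ĥ(1/2+iτ) e^{-iτy} dτ = 0` (Mellin inversion on
the critical line). [cite: Bombieri2000Weil, §2 (inverse Mellin transform on Re s = 1/2)] -/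
theorem integral_weilMellin_mul_cexp_eq_zero {H : ℝ → ℂ} (hH : IsWeilTest H) {y : ℝ} (hy : H y = 0) :
    ∫ τ : ℝ, weilMellin H (1 / 2 + τ * I) * cexp (-(τ * I) * y) = 0 := by
  have h1 := weilMellin_inversion hH (1 / 2) y
  rw [hy, zero_mul, mul_zero] at h1
  rw [← h1]
  congr 1 with τ
  have ht : ((1 / 2 : ℝ) : ℂ) + τ * I = 1 / 2 + τ * I := by push_cast; ring
  rw [ht]

/-- Joint continuity of `(τ, u) ↦ Ĥ(1/2+iτ) · sinc(wτ/2)^m · e^{-iτu}`. [folklore] -/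
private theorem continuous_windowIntegrand {H : ℝ → ℂ} (hH : IsWeilTest H) (w : ℝ) (m : ℕ) :
    Continuous fun p : ℝ × ℝ ↦ weilMellin H (1 / 2 + p.1 * I) *
      ((Real.sinc (w * p.1 / 2) ^ m : ℝ) : ℂ) * cexp (-(p.1 * I) * p.2) := by
  have h1 : Continuous fun p : ℝ × ℝ ↦ weilMellin H (((1 / 2 : ℝ) : ℂ) + p.1 * I) :=
    (continuous_weilMellin_vertical hH.1.continuous hH.2 (1 / 2)).comp continuous_fst
  have e : (fun p : ℝ × ℝ ↦ weilMellin H (1 / 2 + p.1 * I)) =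
      fun p : ℝ × ℝ ↦ weilMellin H (((1 / 2 : ℝ) : ℂ) + p.1 * I) := by
    funext p; push_cast; ring_nf
  have h1' : Continuous fun p : ℝ × ℝ ↦ weilMellin H (1 / 2 + p.1 * I) := by rw [e]; exact h1
  have h2 : Continuous fun p : ℝ × ℝ ↦ ((Real.sinc (w * p.1 / 2) ^ m : ℝ) : ℂ) :=
    continuous_ofReal.comp ((Real.continuous_sinc.comp (by fun_prop)).pow m)
  exact (h1'.mul h2).mul (by fun_prop)

/-- **Annihilation by induction on the envelope order.** Let `H` be a test function with
`H(y) = 0` for all `y ≥ b`, and `w ≥ 0`. Then for every `m` and every `y ≥ b + m·w/2`,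
`∫ Ĥ(1/2+iτ) sinc(wτ/2)^m e^{-iτy} dτ = 0`.
(`m = 0`: inversion. `m → m+1`: `sinc(wτ/2) e^{-iτy} = w⁻¹ ∫_{y-w/2}^{y+w/2} e^{-iτu} du` and Fubini,
the inner points `u ≥ y − w/2 ≥ b + m·w/2`.) Position-side meaning: `sinc(wτ/2)^m e^{-iτy}` is the
transform of the `m`-fold box spline of step `w` centred at `y`, supported in `[y − m·w/2, y + m·w/2]`.
[folklore] -/
theorem integral_weilMellin_mul_sinc_pow_mul_cexp_eq_zero {H : ℝ → ℂ} (hH : IsWeilTest H)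
    {b w : ℝ} (hw : 0 ≤ w) (hzero : ∀ y, b ≤ y → H y = 0) (m : ℕ) {y : ℝ}
    (hy : b + m * w / 2 ≤ y) :
    ∫ τ : ℝ, weilMellin H (1 / 2 + τ * I) * ((Real.sinc (w * τ / 2) ^ m : ℝ) : ℂ) *
      cexp (-(τ * I) * y) = 0 := by
  induction m generalizing y with
  | zero =>
    simp only [pow_zero, Complex.ofReal_one, mul_one]
    exact integral_weilMellin_mul_cexp_eq_zero hH (hzero y (by simpa using hy))
  | succ m ih =>
    rcases hw.eq_or_lt with hw0 | hwpos
    · -- `w = 0`: the envelope is `1`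
      subst hw0
      simp only [zero_mul, zero_div, Real.sinc_zero, one_pow, Complex.ofReal_one, mul_one]
      exact integral_weilMellin_mul_cexp_eq_zero hH (hzero y (by simpa using hy))
    -- `w > 0`: write the last `sinc` factor as a window integral and swap
    have hrepr : ∀ τ : ℝ, weilMellin H (1 / 2 + τ * I) * ((Real.sinc (w * τ / 2) ^ (m + 1) : ℝ) : ℂ) *
        cexp (-(τ * I) * y) = (1 / w : ℂ) * ∫ u in (y - w / 2)..(y + w / 2),
          weilMellin H (1 / 2 + τ * I) * ((Real.sinc (w * τ / 2) ^ m : ℝ) : ℂ) * cexp (-(τ * I) * u) := by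
      intro τ
      rw [intervalIntegral.integral_const_mul, integral_window_cexp]
      have hw' : (w : ℂ) ≠ 0 := Complex.ofReal_ne_zero.2 hwpos.ne'
      push_cast
      field_simp
      ring
    simp_rw [hrepr]
    rw [integral_const_mul]
    have hle : y - w / 2 ≤ y + w / 2 := by linarith
    simp_rw [intervalIntegral.integral_of_le hle]
    -- Fubini
    have hHi : Integrable (fun τ : ℝ ↦ weilMellin H (1 / 2 + τ * I)) := by
      have h := integrable_weilMellin_vertical hH (1 / 2)
      refine h.congr (Eventually.of_forall fun τ ↦ ?_)
      simp only
      congr 1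
      push_cast
      ring
    have hprod : Integrable (Function.uncurry fun (τ : ℝ) (u : ℝ) ↦
        weilMellin H (1 / 2 + τ * I) * ((Real.sinc (w * τ / 2) ^ m : ℝ) : ℂ) * cexp (-(τ * I) * u))
        (volume.prod (volume.restrict (Ioc (y - w / 2) (y + w / 2)))) := by
      have hone : Integrable (fun _ : ℝ ↦ (1 : ℝ)) (volume.restrict (Ioc (y - w / 2) (y + w / 2))) :=
        integrableOn_const (hs := measure_Ioc_lt_top.ne)
      have hdom := hHi.norm.mul_prod hone
      refine hdom.mono' (continuous_windowIntegrand hH w m).aestronglyMeasurable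
        (Eventually.of_forall fun p ↦ ?_)
      obtain ⟨τ, u⟩ := p
      simp only [Function.uncurry_apply_pair, mul_one]
      rw [norm_mul, norm_mul, Complex.norm_real, Real.norm_eq_abs, abs_pow]
      have hexp : ‖cexp (-(τ * I) * u)‖ = 1 := by
        rw [show -(τ * I : ℂ) * (u : ℝ) = ((-(τ * u) : ℝ) : ℂ) * I by push_cast; ring,
          Complex.norm_exp_ofReal_mul_I]
      rw [hexp, mul_one]
      refine mul_le_of_le_one_right (norm_nonneg _) ?_
      exact pow_le_one₀ (abs_nonneg _) (Real.abs_sinc_le_one _)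
    rw [integral_integral_swap hprod]
    -- the inner integrals vanish pointwise on the window
    have hinner : ∀ u ∈ Ioc (y - w / 2) (y + w / 2),
        (∫ τ : ℝ, weilMellin H (1 / 2 + τ * I) * ((Real.sinc (w * τ / 2) ^ m : ℝ) : ℂ) *
          cexp (-(τ * I) * u)) = 0 := by
      intro u hu
      refine ih ?_
      have h1 := hu.1
      push_cast at hy ⊢
      linarith
    rw [setIntegral_eq_zero_of_forall_eq_zero hinner, mul_zero]

/-- `tsupport H^{(j)} ⊆ tsupport H`. [folklore] -/
theorem tsupport_iterate_deriv_subset (H : ℝ → ℂ) (j : ℕ) : tsupport (deriv^[j] H) ⊆ tsupport H := by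
  induction j with
  | zero => simp
  | succ j ih => rw [Function.iterate_succ_apply']; exact tsupport_deriv_subset.trans ih

/-- On the critical line `((g ⋆ g̃)^{(j)})^(1/2 + iτ) = (−iτ)^j |ĝ(1/2+iτ)|²`. [folklore] -/
theorem weilMellin_iterate_deriv_weilConv_weilReflect_half (hg : IsWeilTest g) (j : ℕ) (τ : ℝ) :
    weilMellin (deriv^[j] (weilConv g (weilReflect g))) (1 / 2 + τ * I) =
      (-(τ * I)) ^ j * ((‖weilMellin g (1 / 2 + τ * I)‖ ^ 2 : ℝ) : ℂ) := by
  rw [weilMellin_iterate_deriv (hg.weilConv hg.weilReflect), weilMellin_weilConv_weilReflect_half hg]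
  congr 2
  ring

/-- `τ ↦ |ĝ(1/2+iτ)|² τ^j` is integrable for every `j` (it is, up to the unit `i^j`, the transform of
the test function `(g ⋆ g̃)^{(j)}` on the critical line). [folklore] -/
theorem integrable_norm_sq_weilMellin_mul_pow (hg : IsWeilTest g) (j : ℕ) :
    Integrable fun τ : ℝ ↦ ‖weilMellin g (1 / 2 + τ * I)‖ ^ 2 * τ ^ j := by
  have hH : IsWeilTest (deriv^[j] (weilConv g (weilReflect g))) :=
    isWeilTest_iterate_deriv (hg.weilConv hg.weilReflect) j
  have h := (integrable_weilMellin_vertical hH (1 / 2)).norm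
  refine h.mono' (by
    exact ((continuous_norm_sq_weilMellin_half_line hg).mul (continuous_id.pow j)).aestronglyMeasurable)
    (Eventually.of_forall fun τ ↦ ?_)
  have ht : ((1 / 2 : ℝ) : ℂ) + τ * I = 1 / 2 + τ * I := by push_cast; ring
  simp only [ht, weilMellin_iterate_deriv_weilConv_weilReflect_half hg, norm_mul, norm_pow,
    norm_neg, Complex.norm_I, mul_one, Complex.norm_real, Real.norm_eq_abs]
  exact le_of_eq (by ring)

/-- **Atom annihilation.** For a test function `g` with `tsupport g ⊆ [-t, t]`, all `j, m : ℕ`,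
`w ≥ 0` and `x ≥ 2t + m·w/2`:
`∫ |ĝ(1/2+iτ)|² τ^j sinc(wτ/2)^m cos(xτ) dτ = 0 = ∫ |ĝ(1/2+iτ)|² τ^j sinc(wτ/2)^m sin(xτ) dτ`
— the atom `τ^j sinc(wτ/2)^m e^{-ixτ}` is the transform of a derivative of a box spline supported in
`[x − m·w/2, x + m·w/2] ⊆ [2t, ∞)`, where `g ⋆ g̃` and all its derivatives vanish. This covers the
format-D atom grammar `pt` (`m = 0`), `tri` (`m = 2`), `sp4` (`m = 4`), `sp6` (`m = 6`) of the GRH arm,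
with reach `m·w/2 = 0, w, 2w, 3w`. [folklore] -/
theorem integral_norm_sq_weilMellin_mul_atom_eq_zero (hg : IsWeilTest g) {t : ℝ}
    (hsupp : tsupport g ⊆ Icc (-t) t) (j m : ℕ) {w x : ℝ} (hw : 0 ≤ w)
    (hx : 2 * t + m * w / 2 ≤ x) :
    (∫ τ : ℝ, ‖weilMellin g (1 / 2 + τ * I)‖ ^ 2 *
        (τ ^ j * Real.sinc (w * τ / 2) ^ m * Real.cos (x * τ))) = 0 ∧
      (∫ τ : ℝ, ‖weilMellin g (1 / 2 + τ * I)‖ ^ 2 *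
        (τ ^ j * Real.sinc (w * τ / 2) ^ m * Real.sin (x * τ))) = 0 := by
  set H : ℝ → ℂ := deriv^[j] (weilConv g (weilReflect g)) with hHdef
  have hk : IsWeilTest (weilConv g (weilReflect g)) := hg.weilConv hg.weilReflect
  have hH : IsWeilTest H := isWeilTest_iterate_deriv hk j
  have hHs : tsupport H ⊆ Icc (-(2 * t)) (2 * t) :=
    (tsupport_iterate_deriv_subset _ j).trans (tsupport_weilConv_weilReflect_subset hg.2 hsupp)
  have hzero : ∀ y, 2 * t ≤ y → H y = 0 := by
    intro y hy
    have hIoo := support_subset_Ioo_of_tsupport_subset_Icc hH.1.continuous hHs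
    by_contra hne
    have hmem := hIoo (Function.mem_support.2 hne)
    exact absurd hmem.2 (not_lt.2 hy)
  have hZ := integral_weilMellin_mul_sinc_pow_mul_cexp_eq_zero hH hw hzero m hx
  -- rewrite the integrand through `|ĝ|²`
  set F : ℝ → ℝ := fun τ ↦ ‖weilMellin g (1 / 2 + τ * I)‖ ^ 2 * (τ ^ j * Real.sinc (w * τ / 2) ^ m)
    with hF
  have hint : ∀ τ : ℝ, weilMellin H (1 / 2 + τ * I) * ((Real.sinc (w * τ / 2) ^ m : ℝ) : ℂ) *
      cexp (-(τ * I) * x) = (-I) ^ j * ((F τ : ℂ) * cexp (-(τ * I) * x)) := by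
    intro τ
    rw [hHdef, weilMellin_iterate_deriv_weilConv_weilReflect_half hg]
    simp only [hF]
    push_cast
    ring
  simp_rw [hint] at hZ
  rw [integral_const_mul, mul_eq_zero] at hZ
  have hIj : (-I : ℂ) ^ j ≠ 0 := pow_ne_zero _ (neg_ne_zero.2 Complex.I_ne_zero)
  have hZ' : ∫ τ : ℝ, (F τ : ℂ) * cexp (-(τ * I) * x) = 0 := hZ.resolve_left hIj
  -- integrability of the complex integrand
  have hFi : Integrable fun τ : ℝ ↦ (F τ : ℂ) * cexp (-(τ * I) * x) := by
    have h1 : Integrable fun τ : ℝ ↦ ((‖weilMellin g (1 / 2 + τ * I)‖ ^ 2 * τ ^ j : ℝ) : ℂ) :=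
      (integrable_norm_sq_weilMellin_mul_pow hg j).ofReal
    refine (h1.mul_bdd (c := 1) (g := fun τ : ℝ ↦ ((Real.sinc (w * τ / 2) ^ m : ℝ) : ℂ) *
      cexp (-(τ * I) * x)) (Continuous.aestronglyMeasurable (by fun_prop))
      (Eventually.of_forall fun τ ↦ ?_)).congr (Eventually.of_forall fun τ ↦ ?_)
    · rw [norm_mul, Complex.norm_real, Real.norm_eq_abs, abs_pow,
        show -(τ * I : ℂ) * (x : ℝ) = ((-(τ * x) : ℝ) : ℂ) * I by push_cast; ring,
        Complex.norm_exp_ofReal_mul_I, mul_one]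
      exact pow_le_one₀ (abs_nonneg _) (Real.abs_sinc_le_one _)
    · simp only [hF]
      push_cast
      ring
  have hre := integral_re hFi
  have him := integral_im hFi
  rw [hZ'] at hre him
  simp only [Complex.zero_re, Complex.zero_im, RCLike.re_to_complex, RCLike.im_to_complex] at hre him
  have ere : ∀ τ : ℝ, ((F τ : ℂ) * cexp (-(τ * I) * x)).re =
      ‖weilMellin g (1 / 2 + τ * I)‖ ^ 2 * (τ ^ j * Real.sinc (w * τ / 2) ^ m * Real.cos (x * τ)) := by
    intro τ
    rw [show -(τ * I : ℂ) * (x : ℝ) = ((-(x * τ) : ℝ) : ℂ) * I by push_cast; ring,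
      Complex.exp_ofReal_mul_I, Real.cos_neg, Real.sin_neg]
    simp only [hF, Complex.mul_re, Complex.ofReal_re, Complex.ofReal_im, Complex.add_re,
      Complex.add_im, Complex.mul_im, Complex.I_re, Complex.I_im, Complex.ofReal_neg,
      Complex.neg_re, Complex.neg_im]
    ring
  have eim : ∀ τ : ℝ, ((F τ : ℂ) * cexp (-(τ * I) * x)).im =
      -(‖weilMellin g (1 / 2 + τ * I)‖ ^ 2 * (τ ^ j * Real.sinc (w * τ / 2) ^ m * Real.sin (x * τ))) := by
    intro τ
    rw [show -(τ * I : ℂ) * (x : ℝ) = ((-(x * τ) : ℝ) : ℂ) * I by push_cast; ring,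
      Complex.exp_ofReal_mul_I, Real.cos_neg, Real.sin_neg]
    simp only [hF, Complex.mul_re, Complex.ofReal_re, Complex.ofReal_im, Complex.add_re,
      Complex.add_im, Complex.mul_im, Complex.I_re, Complex.I_im, Complex.ofReal_neg,
      Complex.neg_re, Complex.neg_im]
    ring
  simp_rw [ere] at hre
  simp_rw [eim, integral_neg, neg_eq_zero] at him
  exact ⟨hre, him⟩

end Summit.Ventures.WeilGRH

end
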